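import Summits.ValiantsHypothesis.ValiantsHypothesis.Theorems.LacunarySymmetroidMatrixDescartesDoorA26WallBubblingPolyFamily

/-!
# `DoorA26` / line `wall_bubbling` — THE TRANSVERSAL LIFT: jet surjectivity opens EVERY multiplicity pattern (the triangular solve, all orders)

HONEST FRAMING.  Object-search cell `pub-symmetroid`, crux `Theses.LacunarySymmetroid.DoorA26` (stmt-ValiantsHypothesis-19979; OPEN, typed,
never asserted).  W2 seat val-sym-door-p1 g20, file #85; def-free helper for obligation (R) of `Cruxes/DoorA26/Lines/wall_bubbling.lean`.
Imports #83 `…PolyFamily`.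

THE THEOREM (`mem_twentyLocus_of_jetSurjective`).  LEVEL 0 of the obstruction tower of memo `DOOR-A26-P1G20-NEWTON-LIFT.md` §2, for ALL multiplicity
patterns: symmetric letters `S`, `F = det P`, separated points `z_j` at which `F` vanishes to the orders `m_j` (any), `Σ m_j ≥ 20`; JET SURJECTIVITY — every family of
targets `v j k` (`k + 2 ≤ m_j`) is the jet `(pol(P, Q_X))^{(k)}(z_j)` of the first variation along some symmetric shift `X` (i.e. the realisable variety
is TRANSVERSAL to the multiplicity stratum at `F`); and, per zero, an EVEN-STEP scaling polynomial `A_jσ^{m_j} + Σ_{1 ≤ n ≤ m_j/2} b_{j,n}σ^{m_j−2n}`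
(`A_j = F^{(m_j)}(z_j)/m_j!`, the `b` free) with `m_j + 1` alternation witnesses.  Then `δ ∈ TwentyLocus`.  Proof = the TRIANGULAR SOLVE: letters
`T_0 = S, T_1, …, T_h` (`2h + 1 ≥ max m_j`) chosen level by level — the level-`n` coefficient of `det(Σ_a η^a Q_a)` is `pol(P,Q_{T_n}) + N_n` with `N_n`
depending on lower levels only (#83's mixed determinants), so jet surjectivity prescribes its jets of order `≤ m_j − 2n` at every `z_j` — followed by
#83 with the slope `−2` edge data `α = 1/2, β_j = m_j/2, k_{j,n} = m_j − 2n`.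

WHAT IS HERE.  `mixedPairSum_eq_expSum`, `firstVariation_eq_expSum`, `mixedCoeff_update_succ` (peeling the two new terms of a level), `edge_iff`,
`pairFilter_sum_eq_range_sum` (the bridge between #83's pair sums and level sums), ★★★ `mem_twentyLocus_of_jetSurjective`.  Nothing here bears on
`DoorA26`, `DoorA34`, (W)/(M)/(R), `MatrixDescartes` (18050) or `VP ≠ VNP`; registers unchanged.  No instance is known to feed the hypothesis (no realisable
multiplicity-20 profile is known at all); the theorem is the structural statement «transversal ⇒ lift» for the residual (R).

[folklore] forward substitution.  [this work] the theorem.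
-/

set_option linter.dupNamespace false

namespace Summit.ValiantsHypothesis.ValiantsHypothesis.Theorems.LacunarySymmetroidMatrixDescartes.WallBubbling

open Finset Filter Topology
open Bubbling (TwentyLocus expSum)

/-! ## §1 Level sums of mixed determinants as exponential sums -/

/-- A level sum of mixed determinants of pencils is an exponential sum on `Fin 6 × Fin 6`. [folklore] -/
theorem mixedPairSum_eq_expSum (δ : Fin 6 → ℝ) (T : ℕ → Fin 6 → Matrix (Fin 2) (Fin 2) ℝ) (n : ℕ) :
    (fun t => ∑ a ∈ Finset.range (n + 1),
        ((∑ l, Real.exp (δ l * t) • T a l) 0 0 * (∑ l, Real.exp (δ l * t) • T (n - a) l) 1 1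
          - (∑ l, Real.exp (δ l * t) • T a l) 0 1 * (∑ l, Real.exp (δ l * t) • T (n - a) l) 1 0))
      = expSum (fun p : Fin 6 × Fin 6 => ∑ a ∈ Finset.range (n + 1),
          ((T a p.1) 0 0 * (T (n - a) p.2) 1 1 - (T a p.1) 0 1 * (T (n - a) p.2) 1 0)) (fun p => δ p.1 + δ p.2) := by
  classical
  funext t
  rw [Finset.sum_congr rfl (fun a _ => mixedDet_expPencil δ (T a) (T (n - a)) t)]
  unfold Bubbling.expSum
  rw [Finset.sum_comm]
  exact Finset.sum_congr rfl fun p _ => by rw [Finset.sum_mul]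

/-- The first variation `pol(P, Q_X) = det(P + Q_X) − det P − det Q_X` as an exponential sum on `Fin 6 × Fin 6`. [folklore] -/
theorem firstVariation_eq_expSum (δ : Fin 6 → ℝ) (S X : Fin 6 → Matrix (Fin 2) (Fin 2) ℝ) :
    (fun t => ((∑ l, Real.exp (δ l * t) • S l) + (∑ l, Real.exp (δ l * t) • X l)).det
        - (∑ l, Real.exp (δ l * t) • S l).det - (∑ l, Real.exp (δ l * t) • X l).det)
      = expSum (fun p : Fin 6 × Fin 6 => ((S p.1) 0 0 * (X p.2) 1 1 - (S p.1) 0 1 * (X p.2) 1 0)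
          + ((X p.1) 0 0 * (S p.2) 1 1 - (X p.1) 0 1 * (S p.2) 1 0)) (fun p => δ p.1 + δ p.2) := by
  classical
  funext t
  have hpol : ∀ A B : Matrix (Fin 2) (Fin 2) ℝ, (A + B).det - A.det - B.det
      = (A 0 0 * B 1 1 - A 0 1 * B 1 0) + (B 0 0 * A 1 1 - B 0 1 * A 1 0) := by
    intro A B; simp only [Matrix.det_fin_two, Matrix.add_apply]; ring
  rw [hpol, mixedDet_expPencil, mixedDet_expPencil, expSum_add_coeff]

/-- Peeling a level: with `T' = update T (n+1) X` and `T⁰ = update T (n+1) 0`, the level-`(n+1)` coefficient vector of `T'` is the first-variation vector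
of `X` against `T 0` plus the level-`(n+1)` vector of `T⁰` (which involves the levels `1..n` only). [folklore] -/
theorem mixedCoeff_update_succ (T : ℕ → Fin 6 → Matrix (Fin 2) (Fin 2) ℝ) (n : ℕ) (X : Fin 6 → Matrix (Fin 2) (Fin 2) ℝ) (p : Fin 6 × Fin 6) :
    (∑ a ∈ Finset.range (n + 2), ((Function.update T (n + 1) X a p.1) 0 0 * (Function.update T (n + 1) X (n + 1 - a) p.2) 1 1
        - (Function.update T (n + 1) X a p.1) 0 1 * (Function.update T (n + 1) X (n + 1 - a) p.2) 1 0))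
      = (((T 0 p.1) 0 0 * (X p.2) 1 1 - (T 0 p.1) 0 1 * (X p.2) 1 0) + ((X p.1) 0 0 * (T 0 p.2) 1 1 - (X p.1) 0 1 * (T 0 p.2) 1 0))
        + ∑ a ∈ Finset.range (n + 2), ((Function.update T (n + 1) 0 a p.1) 0 0 * (Function.update T (n + 1) 0 (n + 1 - a) p.2) 1 1
          - (Function.update T (n + 1) 0 a p.1) 0 1 * (Function.update T (n + 1) 0 (n + 1 - a) p.2) 1 0) := by
  rw [Finset.sum_range_succ, Finset.sum_range_succ', Finset.sum_range_succ, Finset.sum_range_succ']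
  have h0 : Function.update T (n + 1) X 0 = T 0 := Function.update_of_ne (by omega) _ _
  have h1 : Function.update T (n + 1) X (n + 1) = X := Function.update_self _ _ _
  have h0' : Function.update T (n + 1) (0 : Fin 6 → Matrix (Fin 2) (Fin 2) ℝ) 0 = T 0 := Function.update_of_ne (by omega) _ _
  have h1' : Function.update T (n + 1) (0 : Fin 6 → Matrix (Fin 2) (Fin 2) ℝ) (n + 1) = 0 := Function.update_self _ _ _
  have hmid : ∀ a ∈ Finset.range n,
      ((Function.update T (n + 1) X (a + 1) p.1) 0 0 * (Function.update T (n + 1) X (n + 1 - (a + 1)) p.2) 1 1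
        - (Function.update T (n + 1) X (a + 1) p.1) 0 1 * (Function.update T (n + 1) X (n + 1 - (a + 1)) p.2) 1 0)
      = ((Function.update T (n + 1) 0 (a + 1) p.1) 0 0 * (Function.update T (n + 1) 0 (n + 1 - (a + 1)) p.2) 1 1
        - (Function.update T (n + 1) 0 (a + 1) p.1) 0 1 * (Function.update T (n + 1) 0 (n + 1 - (a + 1)) p.2) 1 0) := by
    intro a ha
    rw [Finset.mem_range] at ha
    have e1 : Function.update T (n + 1) X (a + 1) = T (a + 1) := Function.update_of_ne (by omega) _ _
    have e2 : Function.update T (n + 1) X (n + 1 - (a + 1)) = T (n + 1 - (a + 1)) := Function.update_of_ne (by omega) _ _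
    have e3 : Function.update T (n + 1) (0 : Fin 6 → Matrix (Fin 2) (Fin 2) ℝ) (a + 1) = T (a + 1) := Function.update_of_ne (by omega) _ _
    have e4 : Function.update T (n + 1) (0 : Fin 6 → Matrix (Fin 2) (Fin 2) ℝ) (n + 1 - (a + 1)) = T (n + 1 - (a + 1)) :=
      Function.update_of_ne (by omega) _ _
    rw [e1, e2, e3, e4]
  rw [Finset.sum_congr rfl hmid, show n + 1 - (n + 1) = 0 from Nat.sub_self _, show n + 1 - 0 = n + 1 from rfl, h0, h1, h0', h1']
  simp only [Pi.zero_apply, Matrix.zero_apply, mul_zero, zero_mul, sub_zero, add_zero]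
  ring

/-- The slope `−2` edge condition: `n + ½ (m − 2n)⁺ = m/2 ⇔ 2n ≤ m`. [folklore] -/
theorem edge_iff (n m : ℕ) : ((n : ℝ) + 1 / 2 * ((m - 2 * n : ℕ) : ℝ) = (m : ℝ) / 2) ↔ 2 * n ≤ m := by
  constructor
  · intro h
    by_contra hlt
    push Not at hlt
    rw [Nat.sub_eq_zero_of_le hlt.le, Nat.cast_zero, mul_zero, add_zero] at h
    have : (m : ℝ) < 2 * (n : ℝ) := by exact_mod_cast hlt
    linarith
  · intro h
    rw [Nat.cast_sub h, Nat.cast_mul, Nat.cast_ofNat]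
    ring

/-- The bridge between #83's pair sums over `Fin (h+1) × Fin (h+1)` and level sums over `range (n+1)`, for `n ≤ h`. [folklore] -/
theorem pairFilter_sum_eq_range_sum {h : ℕ} (g : ℕ → ℕ → ℝ) (n : ℕ) (hn : n ≤ h) :
    (∑ ab ∈ (Finset.univ : Finset (Fin (h + 1) × Fin (h + 1))).filter (fun ab => (ab.1 : ℕ) + ab.2 = n), g ab.1 ab.2)
      = ∑ a ∈ Finset.range (n + 1), g a (n - a) := by
  classical
  refine Finset.sum_nbij' (fun ab => (ab.1 : ℕ))
    (fun a => if ha : a ≤ n then (⟨a, by omega⟩, ⟨n - a, by omega⟩) else (0, 0)) ?_ ?_ ?_ ?_ ?_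
  · intro ab hab
    rw [Finset.mem_filter] at hab
    rw [Finset.mem_range]; omega
  · intro a ha
    rw [Finset.mem_range] at ha
    rw [dif_pos (by omega)]
    simp only [Finset.mem_filter, Finset.mem_univ, true_and]
    omega
  · intro ab hab
    rw [Finset.mem_filter] at hab
    rw [dif_pos (by omega)]
    exact Prod.ext (Fin.ext rfl) (Fin.ext (by show n - (ab.1 : ℕ) = (ab.2 : ℕ); omega))
  · intro a ha
    rw [Finset.mem_range] at ha
    rw [dif_pos (by omega)]
  · intro ab hab
    rw [Finset.mem_filter] at hab
    rw [show ((ab.2 : ℕ)) = n - ab.1 by omega]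

/-! ## §2 The transversal lift -/

/-- ★★★ **JET SURJECTIVITY LIFTS EVERY MULTIPLICITY PATTERN** (see the module docstring for the reading; the triangular solve of memo §4). [this work] -/
theorem mem_twentyLocus_of_jetSurjective (δ : Fin 6 → ℝ) (S : Fin 6 → Matrix (Fin 2) (Fin 2) ℝ) (hS : ∀ l, (S l).IsSymm)
    {r : ℕ} (z : Fin r → ℝ) {ρ : ℝ} (hρ : 0 < ρ) (hsep : ∀ i j : Fin r, i < j → z i + ρ ≤ z j - ρ)
    (m : Fin r → ℕ) (hm : 20 ≤ ∑ j, m j) (h : ℕ) (hh : ∀ j, m j ≤ 2 * h + 1)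
    (hvan : ∀ j, ∀ i < m j, iteratedDeriv i (fun t => (∑ l, Real.exp (δ l * t) • S l).det) (z j) = 0)
    (hJ : ∀ v : Fin r → ℕ → ℝ, ∃ X : Fin 6 → Matrix (Fin 2) (Fin 2) ℝ, (∀ l, (X l).IsSymm) ∧
      ∀ j k, k + 2 ≤ m j → iteratedDeriv k (fun t => ((∑ l, Real.exp (δ l * t) • S l) + (∑ l, Real.exp (δ l * t) • X l)).det
        - (∑ l, Real.exp (δ l * t) • S l).det - (∑ l, Real.exp (δ l * t) • X l).det) (z j) = v j k)
    (b : Fin r → ℕ → ℝ)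
    (σ : (j : Fin r) → Fin (m j + 1) → ℝ) (hσ : ∀ j, StrictMono (σ j)) (hσ0 : ∀ j i, σ j i ≠ 0)
    (ε : (j : Fin r) → Fin (m j + 1) → ℝ) (hεalt : ∀ j (i : Fin (m j)), ε j i.castSucc * ε j i.succ < 0)
    (hM : ∀ j i, 0 < ε j i * ∑ n : Fin (2 * h + 1), if 2 * (n : ℕ) ≤ m j then
        (if (n : ℕ) = 0 then iteratedDeriv (m j) (fun t => (∑ l, Real.exp (δ l * t) • S l).det) (z j) / (m j).factorial else b j n)
          * σ j i ^ (m j - 2 * n) else 0) :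
    δ ∈ TwentyLocus := by
  classical
  set F : ℝ → ℝ := fun t => (∑ l, Real.exp (δ l * t) • S l).det with hF
  -- coefficient vectors on `Fin 6 × Fin 6`
  let ι := Fin 6 × Fin 6
  let x : ι → ℝ := fun p => δ p.1 + δ p.2
  let cf : (Fin 6 → Matrix (Fin 2) (Fin 2) ℝ) → (Fin 6 → Matrix (Fin 2) (Fin 2) ℝ) → ι → ℝ :=
    fun U V p => (U p.1) 0 0 * (V p.2) 1 1 - (U p.1) 0 1 * (V p.2) 1 0
  let cc : (ℕ → Fin 6 → Matrix (Fin 2) (Fin 2) ℝ) → ℕ → ι → ℝ := fun T n p => ∑ a ∈ Finset.range (n + 1), cf (T a) (T (n - a)) p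
  -- targets at level `n ≥ 1`
  let tgt : Fin r → ℕ → ℕ → ℝ := fun j n k => if k + 2 * n = m j then ((m j - 2 * n).factorial : ℝ) * b j n else 0
  -- jets of exponential sums are linear in the coefficients
  have hjet : ∀ (c : ι → ℝ) (k : ℕ) (t : ℝ), iteratedDeriv k (expSum c x) t = ∑ p, (c p * Real.exp (x p * t)) * x p ^ k :=
    fun c k t => iteratedDeriv_expSum_apply c x k t
  have hjet_add : ∀ (c c' : ι → ℝ) (k : ℕ) (t : ℝ),
      iteratedDeriv k (expSum (fun p => c p + c' p) x) t = iteratedDeriv k (expSum c x) t + iteratedDeriv k (expSum c' x) t := by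
    intro c c' k t
    rw [hjet, hjet, hjet, ← Finset.sum_add_distrib]
    exact Finset.sum_congr rfl fun p _ => by ring
  -- THE TRIANGULAR SOLVE
  have solve : ∀ n, n ≤ h → ∃ T : ℕ → Fin 6 → Matrix (Fin 2) (Fin 2) ℝ, T 0 = S ∧ (∀ a l, (T a l).IsSymm) ∧
      ∀ n', 1 ≤ n' → n' ≤ n → ∀ j k, k + 2 * n' ≤ m j → iteratedDeriv k (expSum (cc T n') x) (z j) = tgt j n' k := by
    intro n
    induction n with
    | zero =>
      intro _
      refine ⟨fun a => if a = 0 then S else 0, by simp, ?_, fun n' h1 h2 => absurd h2 (by omega)⟩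
      intro a l
      by_cases ha : a = 0
      · simp only [ha, if_true]; exact hS l
      · simp only [ha, if_false, Pi.zero_apply]; exact Matrix.isSymm_zero
    | succ n ih =>
      intro hn
      obtain ⟨T, hT0, hTs, hcond⟩ := ih (by omega)
      -- the lower-level part of the new coefficient
      let T0 : ℕ → Fin 6 → Matrix (Fin 2) (Fin 2) ℝ := Function.update T (n + 1) 0
      let N : ι → ℝ := cc T0 (n + 1)
      obtain ⟨X, hXs, hXjet⟩ := hJ (fun j k => tgt j (n + 1) k - iteratedDeriv k (expSum N x) (z j))
      let T' : ℕ → Fin 6 → Matrix (Fin 2) (Fin 2) ℝ := Function.update T (n + 1) X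
      refine ⟨T', ?_, ?_, ?_⟩
      · show Function.update T (n + 1) X 0 = S
        rw [Function.update_of_ne (by omega)]; exact hT0
      · intro a l
        show (Function.update T (n + 1) X a l).IsSymm
        by_cases ha : a = n + 1
        · subst ha; rw [Function.update_self]; exact hXs l
        · rw [Function.update_of_ne ha]; exact hTs a l
      · intro n' h1 h2 j k hk
        by_cases hn' : n' ≤ n
        · -- old levels are untouched
          have hcc : cc T' n' = cc T n' := by
            funext p
            refine Finset.sum_congr rfl fun a ha => ?_
            rw [Finset.mem_range] at ha
            have e1 : T' a = T a := Function.update_of_ne (by omega) _ _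
            have e2 : T' (n' - a) = T (n' - a) := Function.update_of_ne (by omega) _ _
            rw [e1, e2]
          rw [hcc]
          exact hcond n' h1 hn' j k hk
        · -- the new level `n' = n + 1`
          have hn1 : n' = n + 1 := by omega
          subst hn1
          have hsplit : cc T' (n + 1) = fun p => (cf (T 0) X p + cf X (T 0) p) + N p := by
            funext p
            exact mixedCoeff_update_succ T n X p
          rw [hsplit, hjet_add]
          -- the first-variation part is prescribed by jet surjectivity
          have hfv : expSum (fun p => cf (T 0) X p + cf X (T 0) p) x
              = fun t => ((∑ l, Real.exp (δ l * t) • S l) + (∑ l, Real.exp (δ l * t) • X l)).det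
                - (∑ l, Real.exp (δ l * t) • S l).det - (∑ l, Real.exp (δ l * t) • X l).det := by
            rw [hT0]; exact (firstVariation_eq_expSum δ S X).symm
          rw [hfv, hXjet j k (by omega)]
          ring
  obtain ⟨T, hT0, hTs, hcond⟩ := solve h le_rfl
  -- the finite family and the bridge to #83
  let Tf : Fin (h + 1) → Fin 6 → Matrix (Fin 2) (Fin 2) ℝ := fun a => T a
  have hbridge : ∀ n : Fin (2 * h + 1), (n : ℕ) ≤ h → (fun t =>
      ∑ ab ∈ (Finset.univ : Finset (Fin (h + 1) × Fin (h + 1))).filter (fun ab => (ab.1 : ℕ) + ab.2 = n),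
        ((∑ l, Real.exp (δ l * t) • Tf ab.1 l) 0 0 * (∑ l, Real.exp (δ l * t) • Tf ab.2 l) 1 1
          - (∑ l, Real.exp (δ l * t) • Tf ab.1 l) 0 1 * (∑ l, Real.exp (δ l * t) • Tf ab.2 l) 1 0)) = expSum (cc T n) x := by
    intro n hn
    rw [← mixedPairSum_eq_expSum δ T n]
    funext t
    exact pairFilter_sum_eq_range_sum (fun a b' => ((∑ l, Real.exp (δ l * t) • T a l) 0 0 * (∑ l, Real.exp (δ l * t) • T b' l) 1 1
          - (∑ l, Real.exp (δ l * t) • T a l) 0 1 * (∑ l, Real.exp (δ l * t) • T b' l) 1 0)) n hn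
  -- level zero is `F`
  have hcc0 : expSum (cc T 0) x = F := by
    rw [← mixedPairSum_eq_expSum δ T 0]
    funext t
    rw [Finset.sum_range_one, Nat.sub_zero, hT0]
    show _ = (∑ l, Real.exp (δ l * t) • S l).det
    rw [Matrix.det_fin_two]
  refine mem_twentyLocus_of_newton_openings_polyFamily δ Tf (fun a l => hTs a l) z hρ hsep m hm (fun _ => 1 / 2) (fun _ => by norm_num)
    (fun j => (m j : ℝ) / 2) (fun j n => m j - 2 * (n : ℕ)) ?_ ?_ σ hσ hσ0 ε hεalt ?_
  · -- vanishing below the edge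
    intro j n i hi
    have hn : (n : ℕ) ≤ h := by have := hh j; omega
    rw [hbridge n hn]
    rcases Nat.eq_zero_or_pos (n : ℕ) with h0 | hpos
    · rw [h0] at hi ⊢
      rw [hcc0]
      exact hvan j i (by omega)
    · rw [hcond n hpos hn j i (by omega)]
      simp only [tgt]
      rw [if_neg (by omega)]
  · -- the weights
    intro j n
    rcases le_or_gt (2 * (n : ℕ)) (m j) with hle | hgt
    · rw [Nat.cast_sub hle, Nat.cast_mul, Nat.cast_ofNat]; linarith
    · rw [Nat.sub_eq_zero_of_le hgt.le, Nat.cast_zero, mul_zero, add_zero]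
      have : (m j : ℝ) < 2 * ((n : ℕ) : ℝ) := by exact_mod_cast hgt
      linarith
  · -- the scaling polynomial is the prescribed even-step polynomial
    intro j i
    convert hM j i using 2
    refine Finset.sum_congr rfl fun n _ => ?_
    by_cases hle : 2 * (n : ℕ) ≤ m j
    · rw [if_pos ((edge_iff n (m j)).2 hle), if_pos hle]
      have hn : (n : ℕ) ≤ h := by have := hh j; omega
      rw [hbridge n hn]
      rcases Nat.eq_zero_or_pos (n : ℕ) with h0 | hpos
      · rw [if_pos h0, h0, hcc0]
        simp
      · rw [if_neg (by omega), hcond n hpos hn j (m j - 2 * n) (by omega)]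
        simp only [tgt, if_pos (show m j - 2 * (n : ℕ) + 2 * n = m j by omega)]
        have hf : ((m j - 2 * (n : ℕ)).factorial : ℝ) ≠ 0 := Nat.cast_ne_zero.2 (Nat.factorial_ne_zero _)
        field_simp
    · rw [if_neg (fun h' => hle ((edge_iff n (m j)).1 h')), if_neg hle]

end Summit.ValiantsHypothesis.ValiantsHypothesis.Theorems.LacunarySymmetroidMatrixDescartes.WallBubbling
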